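import Summits.ABC.ABC.Theorems.PlatonicClosureCloses
import HarnessLib

/-!
# PlatonicClosure — part 4/5 of the node file `PlatonicClosure` (door J, second layer; lens-1 gen 7)

Source: lens-1 g7 `PlatonicClosure.lean` v2.1 (cell `decomp-abc`; sha256 `05826916bf38e332…`; lens + critic + writer
`lean check` rc 0, 0 sorry, axioms standard; critic CLEARED decomp-abc STATUS l.470 / l.479 / l.490).

This module: §8 kernel witnesses (`icoCell_100_243_343`, `octCell_octaImage`) · §9 necessity `S ⟹ P_H`
(`campanaHyperbolicBound_of_abc` via `PolyABC (43/42)`) · §10 exactness `node_iff7 : ABC ↔ P_H ∧ P_E ∧ P_I ∧ P_O` and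
`node_iff_pow`.

Landing form: MECHANICAL five-module split of the source (full account in part 1/5 `PlatonicClosureTransport`): namespace
`Summit.ABC.ABC.Theorems.PlatonicClosure` + `open Summit.ABC.ABC.Theses` (`RootDecompJ/B/G.…` = the TREE decls, as in the source), docstrings,
imports, `private` copies of landed folklore lemmas; statements and proofs byte-identical.  Proves neither `ABC` nor any item (`--supports`).
-/

set_option linter.dupNamespace false
-- lint debt, justified: verbatim planner-cleared proofs keep the item texts' binder names (some hypotheses are unused by name).
set_option linter.unusedVariables false

open Literature.NumberTheory.DiophantineGeometry
open UniqueFactorizationMonoid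
open Finset
-- the route decls of doors J / B / G are referred to as `RootDecompJ.…`, `RootDecompB.…`, `RootDecompG.…` (TREE decls, by name)
open Summit.ABC.ABC.Theses

namespace Summit.ABC.ABC.Theorems.PlatonicClosure

/-! Private verbatim copies (gate `dedup.landed`: these folklore statements are already landed elsewhere in the tree;
they are `private` in their home module of this split) — so that every proof below stays byte-identical to the source. -/
/-- `radical (m * n) ≤ radical m * radical n`. -/
private theorem radical_mul_le (m n : ℕ) : radical (m * n) ≤ radical m * radical n :=
  Nat.le_of_dvd (Nat.mul_pos (Nat.radical_pos _) (Nat.radical_pos _)) radical_mul_dvd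

/-! ## §8  Kernel witnesses: both new cells are populated -/

/-- If `Adm p x`, `ℓ` is a prime dividing `x ≠ 0` and `ℓ^(e+1) ∤ x`, then `p ≤ e`. -/
theorem adm_le_of_not_pow_dvd {p x ℓ e : ℕ} (h : Adm p x) (hℓ : ℓ.Prime) (hℓx : ℓ ∣ x) (hx : x ≠ 0)
    (hne : ¬ ℓ ^ (e + 1) ∣ x) : p ≤ e := by
  by_contra hc
  exact hne ((pow_dvd_pow ℓ (by omega)).trans ((pow_dvd_pow ℓ (h.2 ℓ (Nat.mem_primeFactors.2 ⟨hℓ, hℓx, hx⟩))).trans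
    (Nat.ordProj_dvd x ℓ)))

/-- An admissible multiplicity at a member `≠ 1` is nonzero. -/
theorem adm_ne_zero_of_ne_one {p x : ℕ} (h : Adm p x) (hx : x ≠ 1) : p ≠ 0 := fun h0 => hx (h.1 h0)

/-- **`10² + 3⁵ = 7³` lies in the ICOSAHEDRAL CELL** (profile `(2,5,3)`). -/
theorem icoCell_100_243_343 : IcoCell 100 243 343 := by
  have hA : Adm 2 100 := by
    refine adm_of_pow_dvd (n := 10) two_ne_zero (by norm_num) (by norm_num) fun ℓ hℓ h => ?_
    have : ℓ ∣ 10 ^ 2 := by norm_num; exact h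
    exact hℓ.dvd_of_dvd_pow this
  have hB : Adm 5 243 := by simpa using adm_pow (k := 5) (x := 3) (by norm_num) (by norm_num)
  have hC : Adm 3 343 := by simpa using adm_pow (k := 3) (x := 7) (by norm_num) (by norm_num)
  refine ⟨fun p q r hp hq hr => ?_, ⟨2, 5, 3, hA, hB, hC, by unfold IcoSig; omega⟩⟩
  have hp2 : p ≤ 2 := adm_le_of_not_pow_dvd hp Nat.prime_two (by norm_num) (by norm_num) (by norm_num)
  have hq5 : q ≤ 5 := adm_le_of_not_pow_dvd hq Nat.prime_three (by norm_num) (by norm_num) (by norm_num)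
  have hr3 : r ≤ 3 := adm_le_of_not_pow_dvd hr (by norm_num : Nat.Prime 7) (by norm_num) (by norm_num) (by norm_num)
  have hp0 := Nat.pos_of_ne_zero (adm_ne_zero_of_ne_one hp (by norm_num))
  have hq0 := Nat.pos_of_ne_zero (adm_ne_zero_of_ne_one hq (by norm_num))
  have hr0 := Nat.pos_of_ne_zero (adm_ne_zero_of_ne_one hr (by norm_num))
  interval_cases p <;> interval_cases q <;> interval_cases r <;> norm_num [wt]

/-- `(100, 243, 343)` is an abc triple (`10² + 3⁵ = 7³`). -/
theorem isABCTriple_100_243_343 : IsABCTriple 100 243 343 := ⟨by norm_num, by norm_num, by norm_num, by norm_num⟩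

/-- **the octahedral image of `1 + 1 = 2`** (frame `(2,1)`): `4879² + 108·30⁴ = 481³`, i.e.
`23804641 + 87480000 = 111284641`, lies in the OCTAHEDRAL CELL (profile `(2,4,3)`; `4879 = 7·17·41`, `481 = 13·37`). -/
theorem octCell_octaImage : OctCell 23804641 87480000 111284641 := by
  have hA : Adm 2 23804641 := by
    simpa using adm_pow (k := 2) (x := 4879) (by norm_num) (by norm_num)
  have hB : Adm 4 87480000 := by
    refine adm_of_pow_dvd (n := 30) (by norm_num) (by norm_num) (by norm_num) fun ℓ hℓ h => ?_
    have h' : ℓ ∣ 30 ^ 4 * 108 := by norm_num; exact h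
    rcases (Nat.Prime.dvd_mul hℓ).mp h' with h1 | h1
    · exact hℓ.dvd_of_dvd_pow h1
    · rcases prime_dvd_108 hℓ h1 with e | e <;> subst e <;> norm_num
  have hC : Adm 3 111284641 := by
    simpa using adm_pow (k := 3) (x := 481) (by norm_num) (by norm_num)
  have bounds : ∀ p q r : ℕ, Adm p 23804641 → Adm q 87480000 → Adm r 111284641 →
      0 < p ∧ p ≤ 2 ∧ 0 < q ∧ q ≤ 4 ∧ 0 < r ∧ r ≤ 3 := by
    intro p q r hp hq hr
    refine ⟨Nat.pos_of_ne_zero (adm_ne_zero_of_ne_one hp (by norm_num)),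
      adm_le_of_not_pow_dvd hp (by norm_num : Nat.Prime 7) (by norm_num) (by norm_num) (by norm_num),
      Nat.pos_of_ne_zero (adm_ne_zero_of_ne_one hq (by norm_num)),
      adm_le_of_not_pow_dvd hq (by norm_num : Nat.Prime 5) (by norm_num) (by norm_num) (by norm_num),
      Nat.pos_of_ne_zero (adm_ne_zero_of_ne_one hr (by norm_num)),
      adm_le_of_not_pow_dvd hr (by norm_num : Nat.Prime 13) (by norm_num) (by norm_num) (by norm_num)⟩
  refine ⟨fun p q r hp hq hr => ?_, ⟨2, 4, 3, hA, hB, hC, octSig_243⟩, ?_⟩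
  · obtain ⟨hp0, hp2, hq0, hq4, hr0, hr3⟩ := bounds p q r hp hq hr
    interval_cases p <;> interval_cases q <;> interval_cases r <;> norm_num [wt]
  · rintro ⟨p, q, r, hp, hq, hr, hsig⟩
    obtain ⟨hp0, hp2, hq0, hq4, hr0, hr3⟩ := bounds p q r hp hq hr
    unfold IcoSig at hsig
    omega

/-- `(23804641, 87480000, 111284641)` is an abc triple (`4879² + 108·30⁴ = 481³`). -/
theorem isABCTriple_octaImage : IsABCTriple 23804641 87480000 111284641 :=
  ⟨by norm_num, by norm_num, by norm_num, by norm_num⟩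

/-- the octahedral image really is Klein's identity at the frame `(2,1)` -/
theorem octaImage_eq : tO 2 1 ^ 2 = 23804641 ∧ (108 : ℤ) * (2 * 1 * (2 ^ 4 - 1 ^ 4)) ^ 4 = 87480000 ∧
    ((2 : ℤ) ^ 8 + 14 * 2 ^ 4 * 1 ^ 4 + 1 ^ 8) ^ 3 = 111284641 := by
  refine ⟨by unfold tO; norm_num, by norm_num, by norm_num⟩

/-! ## §9  Necessity `S ⟹ P_H` (copied from gen 6, CampanaTrichotomy.lean §2–§3, rc 0 there) -/

/-- abc triples are symmetric in `a, b`. -/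
private theorem isABCTriple_swap {a b c : ℕ} (ht : IsABCTriple a b c) : IsABCTriple b a c := by
  obtain ⟨ha, hb, habc, hcop⟩ := ht
  exact ⟨hb, ha, by omega, hcop.symm⟩

/-- The radical `rad a b c` is symmetric in `a, b`. -/
private theorem rad_swap (a b c : ℕ) : rad b a c = rad a b c := by
  rw [rad_def, rad_def, mul_comm b a]


/-- `∏ p ∈ m.primeFactors, p ^ m.factorization p = m` for `m ≠ 0`. -/
private theorem prod_primeFactors_pow_factorization {m : ℕ} (hm : m ≠ 0) :
    ∏ p ∈ m.primeFactors, p ^ m.factorization p = m := by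
  calc ∏ p ∈ m.primeFactors, p ^ m.factorization p
      = m.factorization.prod (fun p k => p ^ k) := by
        rw [Finsupp.prod, Nat.support_factorization]
    _ = m := Nat.prod_factorization_pow_eq_self hm

/-- A `p`-full number satisfies `rad(x)ᵖ ≤ x` (also for `p = 0`, `x = 1`). -/
theorem radical_pow_le_of_adm {p x : ℕ} (h : Adm p x) (hx : x ≠ 0) : radical x ^ p ≤ x := by
  rw [Nat.radical_eq_prod_primeFactors, ← Finset.prod_pow]
  calc ∏ ℓ ∈ x.primeFactors, ℓ ^ p ≤ ∏ ℓ ∈ x.primeFactors, ℓ ^ x.factorization ℓ :=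
        Finset.prod_le_prod (fun _ _ => Nat.zero_le _) fun ℓ hℓ =>
          Nat.pow_le_pow_right (Nat.prime_of_mem_primeFactors hℓ).pos (h.2 ℓ hℓ)
    _ = x := prod_primeFactors_pow_factorization hx


/-- `rad a b c ≤ radical a * radical b * radical c`. -/
theorem rad_le_mul (a b c : ℕ) : rad a b c ≤ radical a * radical b * radical c := by
  rw [rad_def]
  exact (radical_mul_le _ _).trans (Nat.mul_le_mul_right _ (radical_mul_le _ _))

/-- In an abc triple no member other than `1` admits multiplicity `0`; `c` never does. -/
theorem adm_c_ne_zero {a b c r : ℕ} (ht : IsABCTriple a b c) (hr : Adm r c) : r ≠ 0 := by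
  obtain ⟨-, -, -, hac, -⟩ := triple_facts ht
  obtain ⟨ha, -, -, -⟩ := ht
  intro h0
  have := hr.1 h0
  omega


/-- Clearing denominators: for `p, q, r ≥ 1`, `1/p + 1/q + 1/r < 1 ↔ qr + rp + pq < pqr`. -/
theorem wt_lt_one_iff {p q r : ℕ} (hp : p ≠ 0) (hq : q ≠ 0) (hr : r ≠ 0) :
    wt p q r < 1 ↔ q * r + r * p + p * q < p * q * r := by
  have hp' : (0 : ℚ) < p := by exact_mod_cast Nat.pos_of_ne_zero hp
  have hq' : (0 : ℚ) < q := by exact_mod_cast Nat.pos_of_ne_zero hq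
  have hr' : (0 : ℚ) < r := by exact_mod_cast Nat.pos_of_ne_zero hr
  have key : wt p q r = ((q * r + r * p + p * q : ℕ) : ℚ) / ((p * q * r : ℕ) : ℚ) := by
    unfold wt
    push_cast
    field_simp
  rw [key, div_lt_one (by positivity)]
  exact_mod_cast Iff.rfl

/-- Two-term version (`a = 1`, weight `0 + 1/q + 1/r`): `1/q + 1/r < 1 ↔ q + r < qr`. -/
theorem wt_zero_lt_one_iff {q r : ℕ} (hq : q ≠ 0) (hr : r ≠ 0) :
    wt 0 q r < 1 ↔ q + r < q * r := by
  have hq' : (0 : ℚ) < q := by exact_mod_cast Nat.pos_of_ne_zero hq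
  have hr' : (0 : ℚ) < r := by exact_mod_cast Nat.pos_of_ne_zero hr
  have key : wt 0 q r = ((q + r : ℕ) : ℚ) / ((q * r : ℕ) : ℚ) := by
    unfold wt
    push_cast
    field_simp
    ring
  rw [key, div_lt_one (by positivity)]
  exact_mod_cast Iff.rfl

/-- The hyperbolic gap (three finite multiplicities): `qr+rp+pq < pqr ⟹ 42(qr+rp+pq) ≤ 41·pqr` (extremal `(2,3,7)`).
[lens-1 g0 `hyperbolic_bound`] -/
theorem hyperbolic_bound {p q r : ℕ} (h : q * r + r * p + p * q < p * q * r) :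
    42 * (q * r + r * p + p * q) ≤ 41 * (p * q * r) := by
  have hp : 2 ≤ p := by
    rcases Nat.lt_or_ge p 2 with h2 | h2
    · interval_cases p
      · simp at h
      · have : q * r + r * 1 + 1 * q = q * r + (r + q) := by ring
        rw [this] at h
        have : 1 * q * r = q * r := by ring
        omega
    · exact h2
  have hq : 2 ≤ q := by
    rcases Nat.lt_or_ge q 2 with h2 | h2
    · interval_cases q
      · simp at h
      · have : 1 * r + r * p + p * 1 = p * r + (r + p) := by ring
        rw [this] at h
        have : p * 1 * r = p * r := by ring
        omega
    · exact h2
  have hr : 2 ≤ r := by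
    rcases Nat.lt_or_ge r 2 with h2 | h2
    · interval_cases r
      · simp at h
      · have : q * 1 + 1 * p + p * q = p * q + (q + p) := by ring
        rw [this] at h
        have : p * q * 1 = p * q := by ring
        omega
    · exact h2
  rcases Nat.lt_or_ge p 5 with hp5 | hp5 <;> rcases Nat.lt_or_ge q 5 with hq5 | hq5 <;>
    rcases Nat.lt_or_ge r 5 with hr5 | hr5
  · interval_cases p <;> interval_cases q <;> interval_cases r <;> omega
  · interval_cases p <;> interval_cases q <;> omega
  · interval_cases p <;> interval_cases r <;> omega
  · interval_cases p <;> nlinarith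
  · interval_cases q <;> interval_cases r <;> omega
  · interval_cases q <;> nlinarith
  · interval_cases r <;> nlinarith
  · nlinarith [Nat.mul_le_mul_left (p * q) hr5, Nat.mul_le_mul_left (q * r) hp5,
      Nat.mul_le_mul_left (r * p) hq5, Nat.zero_le (p * q * r)]

/-- The hyperbolic gap with one infinite multiplicity: `q + r < qr ⟹ 6(q+r) ≤ 5qr` (extremal `(∞,2,3)`). -/
theorem hyperbolic_bound₂ {q r : ℕ} (h : q + r < q * r) : 6 * (q + r) ≤ 5 * (q * r) := by
  rcases Nat.lt_or_ge q 4 with hq4 | hq4 <;> rcases Nat.lt_or_ge r 4 with hr4 | hr4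
  · interval_cases q <;> interval_cases r <;> omega
  · interval_cases q <;> omega
  · interval_cases r <;> omega
  · nlinarith

/-- Hyperbolic triples with `a = 1`: `rad(abc)⁴² < c⁴¹` (indeed `rad⁶ < c⁵`). -/
theorem rad_pow_lt_of_hyp_one {a b c q r : ℕ} (ht : IsABCTriple a b c) (ha : a = 1)
    (hq : Adm q b) (hr : Adm r c) (hw : wt 0 q r < 1) : rad a b c ^ 42 < c ^ 41 := by
  obtain ⟨-, hb0, hc0, -, hbc⟩ := triple_facts ht
  have hr0 : r ≠ 0 := adm_c_ne_zero ht hr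
  have hq0 : q ≠ 0 := by
    intro h0
    have hb1 := hq.1 h0
    -- a = b = 1, c = 2, r ≤ v₂(2) = 1, so the weight is 1, not < 1
    obtain ⟨-, -, habc, -⟩ := ht
    have hc2 : c = 2 := by omega
    subst h0
    have hr1 : r ≤ 1 := by
      have := hr.2 2 (by rw [hc2]; exact Nat.mem_primeFactors.2 ⟨Nat.prime_two, dvd_rfl, two_ne_zero⟩)
      rw [hc2, Nat.Prime.factorization_self Nat.prime_two] at this
      exact this
    interval_cases r
    · exact hr0 rfl
    · norm_num [wt] at hw
  have hlt : q + r < q * r := (wt_zero_lt_one_iff hq0 hr0).1 hw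
  have hgap := hyperbolic_bound₂ hlt
  have hRb : radical b ^ q ≤ b := radical_pow_le_of_adm hq hb0
  have hRc : radical c ^ r ≤ c := radical_pow_le_of_adm hr hc0
  have hrad : rad a b c ≤ radical b * radical c := by
    calc rad a b c ≤ radical a * radical b * radical c := rad_le_mul a b c
      _ = radical b * radical c := by rw [ha, radical_one, one_mul]
  have h1 : (radical b * radical c) ^ (q * r) < c ^ (q + r) := by
    have e1 : (radical b * radical c) ^ (q * r) = (radical b ^ q) ^ r * (radical c ^ r) ^ q := by ring
    have e2 : c ^ (q + r) = c ^ r * c ^ q := by ring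
    rw [e1, e2]
    have hA : (radical b ^ q) ^ r < c ^ r := Nat.pow_lt_pow_left (hRb.trans_lt hbc) hr0
    have hB : (radical c ^ r) ^ q ≤ c ^ q := Nat.pow_le_pow_left hRc _
    exact mul_lt_mul hA hB (by positivity) (Nat.zero_le _)
  have hcpos : 0 < c := Nat.pos_of_ne_zero hc0
  have h2 : ((radical b * radical c) ^ 6) ^ (q * r) < (c ^ 5) ^ (q * r) :=
    calc ((radical b * radical c) ^ 6) ^ (q * r) = ((radical b * radical c) ^ (q * r)) ^ 6 := by ring
      _ < (c ^ (q + r)) ^ 6 := Nat.pow_lt_pow_left h1 (by norm_num)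
      _ = c ^ (6 * (q + r)) := by ring
      _ ≤ c ^ (5 * (q * r)) := Nat.pow_le_pow_right hcpos hgap
      _ = (c ^ 5) ^ (q * r) := by ring
  have h3 : (radical b * radical c) ^ 6 < c ^ 5 :=
    (Nat.pow_lt_pow_iff_left (mul_ne_zero hq0 hr0)).mp h2
  calc rad a b c ^ 42 ≤ (radical b * radical c) ^ 42 := Nat.pow_le_pow_left hrad _
    _ = ((radical b * radical c) ^ 6) ^ 7 := by ring
    _ < (c ^ 5) ^ 7 := Nat.pow_lt_pow_left h3 (by norm_num)
    _ = c ^ 35 := by ring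
    _ ≤ c ^ 41 := Nat.pow_le_pow_right hcpos (by norm_num)

/-- **The integer heart**: a hyperbolic abc triple has `rad(abc)⁴² < c⁴¹`
(`(rad a·rad b·rad c)^{pqr} ≤ a^{qr} b^{rp} c^{pq} < c^{qr+rp+pq}`, then the hyperbolic gap `41/42`;
the cases with a member `1` use the gap `5/6`). -/
theorem rad_pow_lt_of_hyp {a b c : ℕ} (ht : IsABCTriple a b c) (h : HypType a b c) :
    rad a b c ^ 42 < c ^ 41 := by
  obtain ⟨p, q, r, hp, hq, hr, hw⟩ := h
  obtain ⟨ha0, hb0, hc0, hac, hbc⟩ := triple_facts ht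
  have hr0 : r ≠ 0 := adm_c_ne_zero ht hr
  by_cases hp0 : p = 0
  · subst hp0
    exact rad_pow_lt_of_hyp_one ht (hp.1 rfl) hq hr hw
  by_cases hq0 : q = 0
  · subst hq0
    have hw' : wt 0 p r < 1 := by simpa [wt, add_comm, add_left_comm] using hw
    rw [← rad_swap]
    exact rad_pow_lt_of_hyp_one (isABCTriple_swap ht) (hq.1 rfl) hp hr hw'
  have hlt : q * r + r * p + p * q < p * q * r := (wt_lt_one_iff hp0 hq0 hr0).1 hw
  have hgap := hyperbolic_bound hlt
  have hRa : radical a ^ p ≤ a := radical_pow_le_of_adm hp ha0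
  have hRb : radical b ^ q ≤ b := radical_pow_le_of_adm hq hb0
  have hRc : radical c ^ r ≤ c := radical_pow_le_of_adm hr hc0
  have hcpos : 0 < c := Nat.pos_of_ne_zero hc0
  have h1 : (radical a * radical b * radical c) ^ (p * q * r) < c ^ (q * r + r * p + p * q) := by
    have e1 : (radical a * radical b * radical c) ^ (p * q * r) =
        (radical a ^ p) ^ (q * r) * ((radical b ^ q) ^ (r * p) * (radical c ^ r) ^ (p * q)) := by ring
    have e2 : c ^ (q * r + r * p + p * q) = c ^ (q * r) * (c ^ (r * p) * c ^ (p * q)) := by ring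
    rw [e1, e2]
    have hA : (radical a ^ p) ^ (q * r) < c ^ (q * r) :=
      Nat.pow_lt_pow_left (hRa.trans_lt hac) (mul_ne_zero hq0 hr0)
    have hB : (radical b ^ q) ^ (r * p) * (radical c ^ r) ^ (p * q) ≤ c ^ (r * p) * c ^ (p * q) :=
      Nat.mul_le_mul (Nat.pow_le_pow_left (hRb.trans hbc.le) _) (Nat.pow_le_pow_left hRc _)
    exact mul_lt_mul hA hB (by positivity) (Nat.zero_le _)
  have h2 : ((radical a * radical b * radical c) ^ 42) ^ (p * q * r) < (c ^ 41) ^ (p * q * r) :=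
    calc ((radical a * radical b * radical c) ^ 42) ^ (p * q * r)
        = ((radical a * radical b * radical c) ^ (p * q * r)) ^ 42 := by ring
      _ < (c ^ (q * r + r * p + p * q)) ^ 42 := Nat.pow_lt_pow_left h1 (by norm_num)
      _ = c ^ (42 * (q * r + r * p + p * q)) := by ring
      _ ≤ c ^ (41 * (p * q * r)) := Nat.pow_le_pow_right hcpos hgap
      _ = (c ^ 41) ^ (p * q * r) := by ring
  have h3 : (radical a * radical b * radical c) ^ 42 < c ^ 41 :=
    (Nat.pow_lt_pow_iff_left (mul_ne_zero (mul_ne_zero hp0 hq0) hr0)).mp h2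
  calc rad a b c ^ 42 ≤ (radical a * radical b * radical c) ^ 42 := Nat.pow_le_pow_left (rad_le_mul a b c) _
    _ < c ^ 41 := h3


/-- Bridge (`Iff.rfl`) to the TREE decl: door J's `CampanaHyperbolicBound` is a uniform bound `c ≤ B` on the hyperbolic cell. -/
theorem campanaHyperbolicBound_iff :
    RootDecompJ.CampanaHyperbolicBound ↔ ∃ B : ℕ, ∀ a b c : ℕ, IsABCTriple a b c → HypType a b c → c ≤ B := Iff.rfl

/-- Polynomial abc with exponent `θ` (context): `PolyABC(43/42) ⟹ P_H`. -/
def PolyABC (θ : ℝ) : Prop :=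
  ∃ C : ℝ, 0 < C ∧ ∀ a b c : ℕ, IsABCTriple a b c → (c : ℝ) < C * ((rad a b c : ℕ) : ℝ) ^ θ

/-- `ABC` implies the polynomial abc bound `PolyABC θ` for every exponent `θ > 1`. -/
theorem polyABC_of_abc (h : _root_.ABC) {θ : ℝ} (hθ : 1 < θ) : PolyABC θ := by
  rw [_root_.ABC_iff] at h
  obtain ⟨C, hC, hb⟩ := h (θ - 1) (by linarith)
  exact ⟨C, hC, fun a b c ht => by simpa [show (1 : ℝ) + (θ - 1) = θ by ring] using hb a b c ht⟩

/-- **PolyABC(43/42) ⟹ CampanaHyperbolicBound** (`c¹⁷⁶⁴ < C¹⁷⁶⁴·rad¹⁸⁰⁶ ≤ C¹⁷⁶⁴·c¹⁷⁶³` on hyperbolic triples):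
the WEAKER certificate — P_H follows from abc at the SINGLE instance `ε = 1/42`. -/
theorem campanaHyperbolicBound_of_polyABC (h : PolyABC (43 / 42)) : RootDecompJ.CampanaHyperbolicBound := by
  rw [campanaHyperbolicBound_iff]
  obtain ⟨C, _, hb⟩ := h
  set C₁ : ℝ := max C 1 with hC₁
  have hC₁1 : 1 ≤ C₁ := le_max_right _ _
  have hCC₁ : C ≤ C₁ := le_max_left _ _
  refine ⟨⌈C₁ ^ (1764 : ℕ)⌉₊, fun a b c ht hH => ?_⟩
  have h1 := hb a b c ht
  have h4 : rad a b c ^ 42 ≤ c ^ 41 := (rad_pow_lt_of_hyp ht hH).le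
  obtain ⟨-, -, hc, -, -⟩ := triple_facts ht
  have hc0 : 0 < c := Nat.pos_of_ne_zero hc
  set R : ℝ := ((rad a b c : ℕ) : ℝ) with hR
  have hR0 : 0 ≤ R := by positivity
  have h2 : (c : ℝ) < C₁ * R ^ ((43 : ℝ) / 42) :=
    h1.trans_le (mul_le_mul_of_nonneg_right hCC₁ (Real.rpow_nonneg hR0 _))
  have hpow : (R ^ ((43 : ℝ) / 42)) ^ (1764 : ℕ) = R ^ (1806 : ℕ) := by
    rw [← Real.rpow_natCast _ 1764, ← Real.rpow_mul hR0,
      show (43 : ℝ) / 42 * ((1764 : ℕ) : ℝ) = ((1806 : ℕ) : ℝ) by norm_num, Real.rpow_natCast]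
  have h3 : (c : ℝ) ^ (1764 : ℕ) < C₁ ^ (1764 : ℕ) * R ^ (1806 : ℕ) := by
    have := pow_lt_pow_left₀ h2 (by positivity : (0 : ℝ) ≤ c) (by norm_num : (1764 : ℕ) ≠ 0)
    rwa [mul_pow, hpow] at this
  have h4R : R ^ (1806 : ℕ) ≤ (c : ℝ) ^ (1763 : ℕ) := by
    have h4'' : (rad a b c) ^ 1806 ≤ c ^ 1763 := by
      calc (rad a b c) ^ 1806 = ((rad a b c) ^ 42) ^ 43 := by ring
        _ ≤ (c ^ 41) ^ 43 := Nat.pow_le_pow_left h4 43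
        _ = c ^ 1763 := by ring
    rw [hR]
    exact_mod_cast h4''
  have hc1763 : (0 : ℝ) < (c : ℝ) ^ (1763 : ℕ) := by positivity
  have h5 : (c : ℝ) < C₁ ^ (1764 : ℕ) := by
    have : (c : ℝ) * (c : ℝ) ^ (1763 : ℕ) < C₁ ^ (1764 : ℕ) * (c : ℝ) ^ (1763 : ℕ) :=
      calc (c : ℝ) * (c : ℝ) ^ (1763 : ℕ) = (c : ℝ) ^ (1764 : ℕ) := by ring
        _ < C₁ ^ (1764 : ℕ) * R ^ (1806 : ℕ) := h3
        _ ≤ C₁ ^ (1764 : ℕ) * (c : ℝ) ^ (1763 : ℕ) := mul_le_mul_of_nonneg_left h4R (by positivity)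
    exact lt_of_mul_lt_mul_right this hc1763.le
  have h6 : C₁ ^ (1764 : ℕ) ≤ ((⌈C₁ ^ (1764 : ℕ)⌉₊ : ℕ) : ℝ) := Nat.le_ceil _
  exact_mod_cast (h5.trans_le h6).le

/-- **abc ⟹ P_H** (`S ⟹ P_H`), via abc at the single instance `ε = 1/42`. -/
theorem campanaHyperbolicBound_of_abc (h : _root_.ABC) : RootDecompJ.CampanaHyperbolicBound :=
  campanaHyperbolicBound_of_polyABC (polyABC_of_abc h (by norm_num))

/-! ## §10  Exactness of the gen-7 node -/

/-- **`ABC ⟺ P_H ∧ P_E ∧ P_I ∧ P_O`** (every piece NEC; P_O is the declared residual). -/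
theorem node_iff7 : _root_.ABC ↔
    (RootDecompJ.CampanaHyperbolicBound ∧ RootDecompJ.EuclideanABC ∧ IcosahedralABC ∧ OctahedralABC) :=
  ⟨fun h => ⟨campanaHyperbolicBound_of_abc h, euclideanABC_iff.mpr (abcOn_of_abc h _),
      icosahedralABC_iff.mpr (abcOn_of_abc h _), octahedralABC_iff.mpr (abcOn_of_abc h _)⟩,
    fun h => closes7 h.1 h.2.1 h.2.2.1 h.2.2.2⟩

/-- for every `N ≥ 1`: **`ABC ⟺ P_H ∧ P_E ∧ abc|PowCell N`** — the residual can be carried by cells of population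
`≍ B^{2/N}`, nested and with empty intersection (`powCell_nested`, `powCell_evanescent`). -/
theorem node_iff_pow (k : ℕ) : _root_.ABC ↔
    (RootDecompJ.CampanaHyperbolicBound ∧ RootDecompJ.EuclideanABC ∧ AbcOn (PowCell (k + 1))) :=
  ⟨fun h => ⟨campanaHyperbolicBound_of_abc h, euclideanABC_iff.mpr (abcOn_of_abc h _), abcOn_of_abc h _⟩,
    fun h => deloc k h.1 h.2.1 h.2.2⟩

end Summit.ABC.ABC.Theorems.PlatonicClosure
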